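import Literature.AlgebraicGeometry.Motives.DualNumberPoints
import Literature.AlgebraicGeometry.Motives.AlgPointsProperProofs
import Mathlib.RingTheory.DualNumber
import HarnessLib

/-!
# The first component of the dual-number read-out `𝒪_{Y,x₀} → ℂ[ε]` is evaluation at the base point;
# the `ε`-part algebra of a change of trivialisation

Layer `Literature/AlgebraicGeometry/Motives`, namespace `Literature.AlgebraicGeometry.Motives.AbelianVariety` (the
namespace of the tree's dual-number point API `Motives/DualNumberPoints`: `dualNumberOver = Spec ℂ[ε]`, a `ℂ[ε]`-point
`w : dualNumberOver ⟶ Y`, its base point `dualNumberBasePt w` and local homomorphism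
`dualNumberStalkHom w : 𝒪_{Y,x₀} → ℂ[ε]`, Görtz–Wedhorn I (6.3)–(6.4): «tangent vectors are the `k[ε]`-valued points»).
THEOREMS ONLY (no definition, no named fact, no instance), for any `ℂ`-scheme `Y : SchemeOver ℂ`:

* `eval_eq_zero_of_germ_mem_maximalIdeal` — a section whose germ at `P.pt` lies in `𝔪` vanishes at the `ℂ`-point `P`;
* **`fst_dualNumberStalkHom_germ`** — for a `ℂ[ε]`-point `w` and a `ℂ`-point `P` with the same underlying point,
  `(w(germ g)).fst = g(P)`: both `t ↦ (w t).fst` and evaluation at `P` are `ℂ`-algebra characters of `𝒪_{Y,x₀}` killing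
  `𝔪_{x₀}` (the first by `fst_dualNumberStalkHom_eq_zero_iff`, the local homomorphism; the second by Mathlib
  `IsLocalRing.residue_eq_zero_iff`), and they agree on the scalars (`dualNumberStalkHom_germ_scalar`,
  `AlgPoints.eval_scalarRingHom`);
* `snd_eq_of_inl_mul_eq_mul` — in `ℂ[ε]`: from `a·u' = u·G` with `a ∈ ℂ` and `u₀, u'₀ ≠ 0`,
  `G₁ = (u'₁/u'₀ − u₁/u₀)·G₀` — the first-order content of a change of trivialisation `g' = λ g λ'⁻¹` read at a point
  (Mumford, *Abelian Varieties* §13, proof of the Theorem, p. 125: the tangent map of `x ↦ t_x^*L ⊗ L⁻¹` through the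
  first-order variation of transition functions).

Consumer (cell `hodgecm-mathlib`): the Čech read-out of the first-order deformation of the Mumford family
(`AbelianVarieties/MumfordFamilyFirstOrderCech`).  Presearch: GW I (6.3)–(6.4) and GW II Rem. 27.18 (4) give the
dual-number dictionary; the evaluation identity is folklore.  Mathlib searched and used: `Scheme.evaluation`,
`IsLocalRing.residue_eq_zero_iff`, `TrivSqZeroExt.fst_mul/snd_mul/algebraMap_eq_inl`.

## References
* U. Görtz, T. Wedhorn, *Algebraic Geometry I*, 2nd ed. (2020), (6.3)–(6.4) (tangent spaces via `k[ε]`). [GortzWedhorn2020]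
* D. Mumford, *Abelian Varieties* (1970), §13, proof of the Theorem (p. 125). [MumfordAV1970]
-/

noncomputable section

universe u

open CategoryTheory CategoryTheory.Limits AlgebraicGeometry TopologicalSpace
open scoped DualNumber
open Literature.AlgebraicGeometry.Motives (AlgPoints SchemeOver)
open Literature.AlgebraicGeometry.Motives.AlgPoints

namespace Literature.AlgebraicGeometry.Motives.AbelianVariety

/-! ## §1 The `ε`-part algebra in `ℂ[ε]` -/

section Algebra

/-- From `a · u' = u · G` in `ℂ[ε]` with `a ∈ ℂ` and `u, u'` units: `G₁ = (u'₁/u'₀ − u₁/u₀) · G₀` (subscripts = `fst`/`snd`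
components) — the first-order content of a change of trivialisation. [cite: MumfordAV1970, §13 (proof of the Thm. p. 125)] -/
theorem snd_eq_of_inl_mul_eq_mul {a : ℂ} {u u' G : ℂ[ε]} (hu : u.fst ≠ 0) (hu' : u'.fst ≠ 0)
    (h : algebraMap ℂ ℂ[ε] a * u' = u * G) :
    G.snd = (u'.snd / u'.fst - u.snd / u.fst) * G.fst := by
  have h0 := congrArg TrivSqZeroExt.fst h
  have h1 := congrArg TrivSqZeroExt.snd h
  simp only [TrivSqZeroExt.fst_mul, TrivSqZeroExt.snd_mul, TrivSqZeroExt.algebraMap_eq_inl, TrivSqZeroExt.fst_inl,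
    TrivSqZeroExt.snd_inl, smul_eq_mul, MulOpposite.smul_eq_mul_unop, MulOpposite.unop_op, zero_mul,
    add_zero] at h0 h1
  -- `h0 : a * u'₀ = u₀ * G₀`, `h1 : a * u'₁ = u₀ * G₁ + u₁ * G₀`
  have ha : a = u.fst * G.fst / u'.fst := by
    field_simp
    linear_combination h0
  have hG : G.snd = (a * u'.snd - u.snd * G.fst) / u.fst := by
    field_simp
    linear_combination (-1 : ℂ) * h1
  rw [hG, ha]
  field_simp

end Algebra

/-! ## §2 The first component of the read-out is evaluation at the base point -/

section Fst

variable {Y : SchemeOver ℂ} (w : dualNumberOver ⟶ Y)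


/-- A section whose germ lies in `𝔪_x` has value `0` at every `ℂ`-point over `x`. [cite: GortzWedhorn2020, (6.3)–(6.4)] -/
theorem eval_eq_zero_of_germ_mem_maximalIdeal (P : AlgPoints Y ℂ) (U : Y.left.Opens) (hP : P.pt ∈ U)
    (f : Γ(Y.left, U)) (h : Y.left.presheaf.germ U P.pt hP f ∈ IsLocalRing.maximalIdeal _) : P.eval U hP f = 0 := by
  change P.resHom (Y.left.evaluation U P.pt hP f) = 0
  rw [Scheme.evaluation, CommRingCat.comp_apply]
  change P.resHom (IsLocalRing.residue _ (Y.left.presheaf.germ U P.pt hP f)) = 0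
  rw [(IsLocalRing.residue_eq_zero_iff _).2 h]
  exact _root_.map_zero P.resHom.hom

/-- `P.eval` is additive: differences. [folklore] -/
private theorem eval_sub' (P : AlgPoints Y ℂ) (U : Y.left.Opens) (h : P.pt ∈ U) (a b : Γ(Y.left, U)) :
    P.eval U h (a - b) = P.eval U h a - P.eval U h b := by
  change P.resHom (Y.left.evaluation U P.pt h (a - b)) =
    P.resHom (Y.left.evaluation U P.pt h a) - P.resHom (Y.left.evaluation U P.pt h b)
  rw [_root_.map_sub, _root_.map_sub]

/-- `P.eval` is multiplicative. [folklore] -/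
private theorem eval_mul' (P : AlgPoints Y ℂ) (U : Y.left.Opens) (h : P.pt ∈ U) (a b : Γ(Y.left, U)) :
    P.eval U h (a * b) = P.eval U h a * P.eval U h b := by
  change P.resHom (Y.left.evaluation U P.pt h (a * b)) =
    P.resHom (Y.left.evaluation U P.pt h a) * P.resHom (Y.left.evaluation U P.pt h b)
  rw [_root_.map_mul, _root_.map_mul]

/-- `P.eval` commutes with negation. [folklore] -/
private theorem eval_neg' (P : AlgPoints Y ℂ) (U : Y.left.Opens) (h : P.pt ∈ U) (a : Γ(Y.left, U)) :
    P.eval U h (-a) = -P.eval U h a := by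
  change P.resHom (Y.left.evaluation U P.pt h (-a)) = -P.resHom (Y.left.evaluation U P.pt h a)
  rw [_root_.map_neg, _root_.map_neg]

/-- **The first component of the dual-number read-out is EVALUATION at the base point**: for a `ℂ[ε]`-point `w`
of `Y` and a `ℂ`-point `P` with the same underlying point, `(w(germ g)).fst = g(P)` (both are `ℂ`-algebra characters
of `𝒪_{Y,x₀}` killing `𝔪_{x₀}`). [cite: GortzWedhorn2020, (6.3)–(6.4)] -/
theorem fst_dualNumberStalkHom_germ (P : AlgPoints Y ℂ) (hP : dualNumberBasePt w = P.pt) (U : Y.left.Opens)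
    (hU : dualNumberBasePt w ∈ U) (g : Γ(Y.left, U)) :
    (dualNumberStalkHom w (Y.left.presheaf.germ U _ hU g)).fst = P.eval U (hP ▸ hU) g := by
  set c := (dualNumberStalkHom w (Y.left.presheaf.germ U _ hU g)).fst with hc
  -- `g - c` has read-out with vanishing first component, hence its germ lies in `𝔪`
  have hsc : dualNumberStalkHom w (Y.left.presheaf.germ U _ hU (SchemeOver.scalarRingHom Y U c)) =
      algebraMap ℂ ℂ[ε] c := by
    rw [SchemeOver.scalarRingHom_apply, Scheme.Hom.appLE, CommRingCat.comp_apply, TopCat.Presheaf.germ_res_apply]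
    exact dualNumberStalkHom_germ_scalar w c
  have hm : Y.left.presheaf.germ U _ hU (g - SchemeOver.scalarRingHom Y U c) ∈ IsLocalRing.maximalIdeal _ := by
    rw [← fst_dualNumberStalkHom_eq_zero_iff, _root_.map_sub, _root_.map_sub, TrivSqZeroExt.fst_sub, hsc,
      TrivSqZeroExt.algebraMap_eq_inl, TrivSqZeroExt.fst_inl, sub_self]
  -- transport the membership to the point of `P` and evaluate
  have hm' : ∀ (x : Y.left) (hx : x ∈ U), dualNumberBasePt w = x →
      Y.left.presheaf.germ U x hx (g - SchemeOver.scalarRingHom Y U c) ∈ IsLocalRing.maximalIdeal _ := by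
    rintro x hx rfl
    exact hm
  have h0 := eval_eq_zero_of_germ_mem_maximalIdeal P U (hP ▸ hU) _ (hm' P.pt (hP ▸ hU) hP)
  rw [eval_sub', AlgPoints.eval_scalarRingHom, sub_eq_zero] at h0
  rw [h0]
  rfl

end Fst

end Literature.AlgebraicGeometry.Motives.AbelianVariety

end
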